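import Summits.KontsevichZagierPeriods.KontsevichZagierPeriods.Theses.HurwitzMicroSectors
import Summits.KontsevichZagierPeriods.KontsevichZagierPeriods.Theorems.HurwitzMicroSectorsNormalFormPrinciplePiBoxTransfer
import Summits.KontsevichZagierPeriods.KontsevichZagierPeriods.Theorems.HurwitzMicroSectorsNormalFormPrincipleVariants2283

/-! TTRL-lite variant V2313 of stmt-KontsevichZagierPeriods-3869

Variant V2313 = `stub_boxRigidity` (the leaf `BoxRigidity` of `NormalFormPrinciple`: two representations
on open unit boxes with integrands of KZ's rational shape `p/q` over `ℚ` and equal values are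
KZ-equivalent) with BOTH dimensions frozen to the SAME value, `fix m := 6; fix m' := 6` — i.e. literally
`BoxRigidity` at dimension `6`. Verdict of the attempt seat: **open** — this file is the exact-strength
certificate, not a proof of the variant. Writing `BoxVanishing K` for "a box-rational representation of
dimension `K` and value `0` is a relation": the diagonal freeze `(6, 6)` is exactly `BoxVanishing 6`
(`stub_boxRigidity_var2313_iff_boxVanishing_six`, the instance `max 6 6 = 6` of the tree's
`boxRigidityPair_iff_boxVanishingDim`), hence the same statement as the bounded two-sided leaf
`BoxRigidity(m, m' ≤ 6)` (`…_iff_le_six`) and as the already-certified siblings V2304 (pair `(6,3)`) and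
V2227 (pair `(2,6)`) (`…_iff_var2304`, `…_iff_var2227`, all three being `BoxVanishing 6`); it yields `BoxVanishing j` for every `j ≤ 6`
(`boxVanishing_le_six_of_stub_boxRigidity_var2313`) and is implied by `BoxVanishing 6` alone, by the
parent leaf, and by the Summit (`…_of_boxVanishing_six`, `…_of_parent`, `…_of_statement`).
Why open: `BoxVanishing 6 ⊇ BoxVanishing 5 ∋` "for `a b : ℚ`, `a + b·ζ(5) = 0 ⇒ [a + b/(1 − x₁⋯x₅)]_{(0,1)⁵}`
is a relation" (today only via `ζ(5) ∉ ℚ`, open), `⊇ BoxVanishing 3 ∋` the case split `ζ(3) ∈ ℚ + ℚπ²`,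
`⊇ BoxVanishing 2 ∋` Catalan's dichotomy; conversely a refutation of V2313 refutes `KontsevichZagierPeriods`
and the tree has no additive invariant of `KZ.relations` finer than `KZ.eval` (the invariants under
`Theorems/NormalFormPrinciple/Negative/` are for proper sub-calculi only).
Source: M. Kontsevich, D. Zagier, *Periods* (2001), §1.2 Conjecture 1 and rules 1)–3). Pure proof file,
no definitions. -/

-- `Summit.<Summit>.<Problem>` is the tree's mandated summit-side namespace (CONVENTIONS §2); for this
-- single-conjunct summit the two coincide, so the duplicate is deliberate.
set_option linter.dupNamespace false

noncomputable section

namespace Summit.KontsevichZagierPeriods.KontsevichZagierPeriods.Theorems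

open MeasureTheory Set
open Literature.NumberTheory.Transcendental Literature.NumberTheory.Transcendental.KZ
open Summit.KontsevichZagierPeriods.KontsevichZagierPeriods.Theses.HurwitzMicroSectors
open Summit.KontsevichZagierPeriods.HurwitzMicroSectors.NormalFormPrinciple.PiBox

/-! ## The variant V2313 itself: exactly `BoxVanishing 6` -/

/-- **V2313 ⟺ `BoxVanishing 6`**: the diagonal freeze `(m, m') = (6, 6)` of `stub_boxRigidity` is the
statement that a box-rational representation on the `6`-box of value `0` is a relation (instance
`(K, m₀) = (6, 6)` of `boxRigidityPair_iff_boxVanishingDim`, `max 6 6 = 6`).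
[cite: KontsevichZagier2001, §1.2 Conjecture 1] -/
theorem stub_boxRigidity_var2313_iff_boxVanishing_six :
    (∀ (N : IntegralRep 6) (N' : IntegralRep 6), N.domain = {x | ∀ i, x i ∈ Set.Ioo (0:ℝ) 1} → N.IsRational → N'.domain = {x | ∀ i, x i ∈ Set.Ioo (0:ℝ) 1} → N'.IsRational → N.value = N'.value → Equivalent N N') ↔
    (∀ (M : IntegralRep 6), M.domain = {x | ∀ i, x i ∈ Set.Ioo (0:ℝ) 1} →
      M.IsRational → M.value = 0 → of M ∈ relations) := by
  have h := boxRigidityPair_iff_boxVanishingDim 6 6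
  rwa [max_self] at h

/-- **V2313 ⟺ the two-sided bounded leaf `BoxRigidity(m, m' ≤ 6)`** (the honest strength of the
variant: Conjecture 1 for all pairs of rational integrands on the open unit boxes of dimension at most
`6` — among these periods `π²`, `π⁴`, `π⁶`, `ζ(3)`, `ζ(5)`, `ζ(3)²`, Catalan's `G` and every multiple zeta
value of weight `≤ 6`; smaller boxes are reached by padding with unit intervals).
[cite: KontsevichZagier2001, §1.2 Conjecture 1] -/
theorem stub_boxRigidity_var2313_iff_le_six :
    (∀ (N : IntegralRep 6) (N' : IntegralRep 6), N.domain = {x | ∀ i, x i ∈ Set.Ioo (0:ℝ) 1} → N.IsRational → N'.domain = {x | ∀ i, x i ∈ Set.Ioo (0:ℝ) 1} → N'.IsRational → N.value = N'.value → Equivalent N N') ↔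
    (∀ (m m' : ℕ) (N : IntegralRep m) (N' : IntegralRep m'), m ≤ 6 → m' ≤ 6 →
      N.domain = {x | ∀ i, x i ∈ Set.Ioo (0:ℝ) 1} → N.IsRational →
      N'.domain = {x | ∀ i, x i ∈ Set.Ioo (0:ℝ) 1} → N'.IsRational →
      N.value = N'.value → Equivalent N N') := by
  have h := boxRigidityPair_iff_boxRigidityLe 6 6
  rwa [max_self] at h

/-- **V2313 ⟺ the sibling V2304** (`fix_nat:m=6; fix_nat:m'=3`): both pairs have larger dimension `6`,
so both are `BoxVanishing 6` (`boxRigidityPair_iff_boxVanishingDim`). [cite: KontsevichZagier2001, §1.2 Conjecture 1] -/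
theorem stub_boxRigidity_var2313_iff_var2304 :
    (∀ (N : IntegralRep 6) (N' : IntegralRep 6), N.domain = {x | ∀ i, x i ∈ Set.Ioo (0:ℝ) 1} → N.IsRational → N'.domain = {x | ∀ i, x i ∈ Set.Ioo (0:ℝ) 1} → N'.IsRational → N.value = N'.value → Equivalent N N') ↔
    (∀ (N : IntegralRep 6) (N' : IntegralRep 3), N.domain = {x | ∀ i, x i ∈ Set.Ioo (0:ℝ) 1} →
      N.IsRational → N'.domain = {x | ∀ i, x i ∈ Set.Ioo (0:ℝ) 1} → N'.IsRational →
      N.value = N'.value → Equivalent N N') := by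
  have h := boxRigidityPair_iff_boxVanishingDim 6 3
  rw [show max 6 3 = 6 from by norm_num] at h
  rw [stub_boxRigidity_var2313_iff_boxVanishing_six, h]

/-- **V2313 ⟺ the sibling V2227** (`fix_nat:m=2; fix_nat:m'=6`): both pairs have larger dimension `6`,
so both are `BoxVanishing 6` (`boxRigidityPair_iff_boxVanishingDim`). [cite: KontsevichZagier2001, §1.2 Conjecture 1] -/
theorem stub_boxRigidity_var2313_iff_var2227 :
    (∀ (N : IntegralRep 6) (N' : IntegralRep 6), N.domain = {x | ∀ i, x i ∈ Set.Ioo (0:ℝ) 1} → N.IsRational → N'.domain = {x | ∀ i, x i ∈ Set.Ioo (0:ℝ) 1} → N'.IsRational → N.value = N'.value → Equivalent N N') ↔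
    (∀ (N : IntegralRep 2) (N' : IntegralRep 6), N.domain = {x | ∀ i, x i ∈ Set.Ioo (0:ℝ) 1} →
      N.IsRational → N'.domain = {x | ∀ i, x i ∈ Set.Ioo (0:ℝ) 1} → N'.IsRational →
      N.value = N'.value → Equivalent N N') := by
  have h := boxRigidityPair_iff_boxVanishingDim 2 6
  rw [show max 2 6 = 6 from by norm_num] at h
  rw [stub_boxRigidity_var2313_iff_boxVanishing_six, h]

/-! ## Consequences downward, and the variant from above -/

/-- **V2313 ⇒ `BoxVanishing` in every dimension `j ≤ 6`**: compare a vanishing box-rational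
representation on `(0,1)ʲ` with the zero representation on the same box, via the bounded leaf
(`stub_boxRigidity_var2313_iff_le_six`); in particular the dimension-`5` statement containing the `ζ(5)`
dichotomy and the dimension-`2` one containing Catalan's. [cite: KontsevichZagier2001, §1.2 Conjecture 1] -/
theorem boxVanishing_le_six_of_stub_boxRigidity_var2313
    (h : ∀ (N : IntegralRep 6) (N' : IntegralRep 6), N.domain = {x | ∀ i, x i ∈ Set.Ioo (0:ℝ) 1} → N.IsRational → N'.domain = {x | ∀ i, x i ∈ Set.Ioo (0:ℝ) 1} → N'.IsRational → N.value = N'.value → Equivalent N N')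
    {j : ℕ} (hj : j ≤ 6) (N : IntegralRep j) (hNd : N.domain = {x | ∀ i, x i ∈ Set.Ioo (0:ℝ) 1})
    (hNr : N.IsRational) (hv : N.value = 0) : of N ∈ relations := by
  have hpair : ∀ (N : IntegralRep j) (N' : IntegralRep j), N.domain = {x | ∀ i, x i ∈ Set.Ioo (0:ℝ) 1} →
      N.IsRational → N'.domain = {x | ∀ i, x i ∈ Set.Ioo (0:ℝ) 1} → N'.IsRational →
      N.value = N'.value → Equivalent N N' :=
    fun N N' => stub_boxRigidity_var2313_iff_le_six.1 h j j N N' hj hj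
  have hvan := (boxRigidityPair_iff_boxVanishingDim j j).1 hpair
  rw [max_self] at hvan
  exact hvan N hNd hNr hv

/-- **`BoxVanishing 6` alone already proves V2313** (the honest residual of the variant: whoever
settles Conjecture 1 for vanishing box-rational periods of dimension `6` settles V2313, and conversely).
[cite: KontsevichZagier2001, §1.2 Conjecture 1] -/
theorem stub_boxRigidity_var2313_of_boxVanishing_six
    (hvan : ∀ (M : IntegralRep 6), M.domain = {x | ∀ i, x i ∈ Set.Ioo (0:ℝ) 1} → M.IsRational →
      M.value = 0 → of M ∈ relations) :
    ∀ (N : IntegralRep 6) (N' : IntegralRep 6), N.domain = {x | ∀ i, x i ∈ Set.Ioo (0:ℝ) 1} → N.IsRational → N'.domain = {x | ∀ i, x i ∈ Set.Ioo (0:ℝ) 1} → N'.IsRational → N.value = N'.value → Equivalent N N' :=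
  stub_boxRigidity_var2313_iff_boxVanishing_six.2 hvan

/-- **The parent leaf ⇒ V2313** (specialisation `m := 6`, `m' := 6`; the converse is not claimed —
the parent is `BoxVanishing` in ALL dimensions). [cite: KontsevichZagier2001, §1.2 Conjecture 1] -/
theorem stub_boxRigidity_var2313_of_parent
    (h : ∀ (m m' : ℕ) (N : IntegralRep m) (N' : IntegralRep m'), N.domain = {x | ∀ i, x i ∈ Set.Ioo (0:ℝ) 1} → N.IsRational → N'.domain = {x | ∀ i, x i ∈ Set.Ioo (0:ℝ) 1} → N'.IsRational → N.value = N'.value → Equivalent N N') :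
    ∀ (N : IntegralRep 6) (N' : IntegralRep 6), N.domain = {x | ∀ i, x i ∈ Set.Ioo (0:ℝ) 1} → N.IsRational → N'.domain = {x | ∀ i, x i ∈ Set.Ioo (0:ℝ) 1} → N'.IsRational → N.value = N'.value → Equivalent N N' :=
  h 6 6

/-- **`KontsevichZagierPeriods ⇒ V2313`**: the variant is a special case of Conjecture 1 for the
tree's calculus (`leaves_of_statement`) — so a refutation of the variant would refute the Summit.
[cite: KontsevichZagier2001, §1.2 Conjecture 1] -/
theorem stub_boxRigidity_var2313_of_statement (h : _root_.KontsevichZagierPeriods) :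
    ∀ (N : IntegralRep 6) (N' : IntegralRep 6), N.domain = {x | ∀ i, x i ∈ Set.Ioo (0:ℝ) 1} → N.IsRational → N'.domain = {x | ∀ i, x i ∈ Set.Ioo (0:ℝ) 1} → N'.IsRational → N.value = N'.value → Equivalent N N' :=
  (leaves_of_statement h).1 6 6

end Summit.KontsevichZagierPeriods.KontsevichZagierPeriods.Theorems

end
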